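import Mathlib
import HarnessLib
import Literature.MathematicalPhysics.QuantumLattice.SectorisedIncrementBoundBinomialPrescribedPlateau
import Summits.HubbardSuperconductivity.HubbardSuperconductivity.Theorems.KLProgrammeKLRegimeEngineTowerBlockStepWt
import Summits.HubbardSuperconductivity.HubbardSuperconductivity.Theorems.KLProgrammeKLRegimeEngineNormsJumpResectorisationPrescribed

/-!
# Route `KLProgramme` — crux K3 ENGINE (stmt-HubbardSuperconductivity-20437 `KLRegimeEngineV17F2`), stub (b) v2, THE LEVELS PACKAGE (ℓ):
# instantiation (I1), MODEL HALF, LEVELLED (PRESCRIBED-LEGS) TRACK — the two prescribed (Hstep) doors AT A BLOCK STEP, plateau and parent facts discharged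
# (E1-LEVELS-BLUEPRINT-g8 §1 / (I1); E1 lead r2d-p2 g8)

Twin of `…EngineTowerBlockStepWt` for the all-known / levels track (`b₂` of the kit): the E1 lead's PRESCRIBED doors
(`Literature/…/SectorisedIncrementBoundGradedPrescribedPlateau` p568996, `…BinomialPrescribedPlateau` p571169) at the block geometry `Γ = C^K_{(Λ_{J₂}, Λ_{J₁}]}`,
input family `F_{J₁−1}` + fat partner `F̃_{J₁−1}`, output family `F_{J′}` (`1 ≤ J₁ ≤ J₂`, `J₁ ≤ J′`).  Besides the four plateau facts of §1 of the weighted file,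
the prescribed doors take a CHILD RELATION between fine and coarse sector indices with (i) `hvan`: an entry of the overlap matrix `E(F_{J′})·S(F̃_{J₁−1})` is
nonzero only between a child and a parent with equal spin and charge, and (ii) a parents count `ρc`.  Here the child relation is SUPPORT OVERLAP
(`∃ q, F_{J′} ω″ q ≠ 0 ∧ F̃_{J₁−1} ω′ q ≠ 0`), (i) is `overlap_of_sectorAnalysis_mul_sectorSub_ne_zero` (from the tree's entry formula
`sectorAnalysis_mul_sectorSub_apply`), and (ii) is k3c2-p3's `card_parentsLeg_klAniso_le` (`ρc = 27`, p4's count):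

* §1 `overlap_of_sectorAnalysis_mul_sectorSub_ne_zero` (any two families);
* §2 **`blockStep_ordersGe2_lev_le`** — orders ≥ 2, output legs `J` prescribed, pinned leg `p ∉ J`, graded RHS in the prescribed input sizes `B m′ Fc` of `G` at
  `F_{J₁−1}`, parents constant `27`; block constants (`κ`, `α`, `(cr, cc)`, `ρ`, `θ < 1`) as named hypotheses;
* §3 **`blockStep_firstOrder_lev_le`** — first order likewise (binomial-prescribed RHS).
Compositions of landed theorems; nothing about the model is asserted beyond them; nothing asserts superconductivity.
-/

noncomputable section

namespace Summit.HubbardSuperconductivity.HubbardSuperconductivity.Theorems.EngineV8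

set_option linter.dupNamespace false -- summit = problem name (single-conjunct summit), D-0017

open Real Finset Literature.MathematicalPhysics.QuantumLattice Literature.Probability.LatticeModels GrassmannAlgebra
open Summit.HubbardSuperconductivity.HubbardSuperconductivity.Theorems.KLProgrammeLegKernels
open Summit.HubbardSuperconductivity.HubbardSuperconductivity.Theorems.KLRegimeSplit
open Summit.HubbardSuperconductivity.HubbardSuperconductivity.Theorems.KLRegimeWick
open Summit.HubbardSuperconductivity.HubbardSuperconductivity.Theorems.TwoPointAssembly

variable {L M : ℕ} [NeZero L]

/-! ## §1 The overlap matrix couples only overlapping sectors with equal spin and charge -/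

/-- **An entry of `E(F′)·S(F)` is nonzero only if the two sector indices have overlapping supports and the spin and charge labels agree** (from the entry
formula `sectorAnalysis_mul_sectorSub_apply`). -/
theorem overlap_of_sectorAnalysis_mul_sectorSub_ne_zero {N N' : ℕ} (β : ℝ) (F' : Fin N' → FreqMomentum L M → ℂ) (F : Fin N → FreqMomentum L M → ℂ)
    (Y' : SpaceTimeIdx L M × SectorLeg N') (Y : SpaceTimeIdx L M × SectorLeg N)
    (h : (sectorAnalysisMatrix L M β F' * sectorSubMatrix L M β F) Y' Y ≠ 0) :
    (∃ q : FreqMomentum L M, F' Y'.2.1.1 q ≠ 0 ∧ F Y.2.1.1 q ≠ 0) ∧ Y.2.1.2 = Y'.2.1.2 ∧ Y.2.2 = Y'.2.2 := by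
  rw [sectorAnalysis_mul_sectorSub_apply] at h
  split_ifs at h with hlab
  · refine ⟨?_, hlab.1, hlab.2⟩
    obtain ⟨k, _, hk⟩ := Finset.exists_ne_zero_of_sum_ne_zero h
    refine ⟨k, fun h0 => hk ?_, fun h0 => hk ?_⟩
    · rw [h0, zero_mul, zero_mul]
    · rw [h0, zero_mul, mul_zero, mul_zero]
  · exact absurd rfl h

/-! ## §2 Orders ≥ 2 of a block step, levelled track -/

section Doors

variable [NeZero M]

/-- **ORDERS ≥ 2 OF A BLOCK STEP, PRESCRIBED LEGS (the graded prescribed door at the block geometry).**  `1 ≤ J₁ ≤ J₂`, `J₁ ≤ J′`; child relation = support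
overlap of `F_{J′}` with `F̃_{J₁−1}` (parents count `27`); `G` even without constant part; block constants as hypotheses; prescribed input sizes `B m′ Fc` of `G`
at `F_{J₁−1}`; output legs `J` prescribed to `τ″`, pinned leg `p ∉ J`. -/
theorem blockStep_ordersGe2_lev_le {β : ℝ} (hβ : 0 < β) (μ : ℝ) (K : TrigPolyC4v) {J₁ J₂ J' : ℕ} (hJ₁ : 1 ≤ J₁) (hJ : J₁ ≤ J₂) (hJ' : J₁ ≤ J')
    (G : HubbardGrassmann L M) (hG : G ∈ evenPart ℂ (HubbardFieldIdx L M)) (hG0 : constPart ℂ G = 0)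
    {κ : ℝ} (hκ : 0 < κ)
    (hGB : IsGramBoundedR ((sectorSubMatrix L M β (bgmFatMultiplier L M klE0 β (nambuXiCT L μ K) (J₁ - 1))).transpose *
      hubbardCovSliceCT L M β μ 0 K (klScale klE0 J₂) (klScale klE0 J₁) *
        sectorSubMatrix L M β (bgmFatMultiplier L M klE0 β (nambuXiCT L μ K) (J₁ - 1))) κ)
    (B : ℕ → ℕ → ℝ) (hB0 : ∀ m' Fc, 0 ≤ B m' Fc)
    (hB : ∀ (m' Fc : ℕ) (E : Finset (Fin (2 * m' + 1 + 1))) (τ : Fin (2 * m' + 1 + 1) → SectorLeg (sectorCount (J₁ - 1)))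
      (q : Fin (2 * m' + 1 + 1)), q ∈ E → E.card = Fc + 1 → ∀ y : SpaceTimeIdx L M,
        imagTimeWeight β M ^ (2 * m' + 1) *
          ∑ σ ∈ univ.filter (fun σ : Fin (2 * m' + 1 + 1) → SectorLeg (sectorCount (J₁ - 1)) => ∀ e ∈ E, σ e = τ e),
            ∑ x ∈ univ.filter (fun x : Fin (2 * m' + 1 + 1) → SpaceTimeIdx L M => x q = y),
              ‖sectorisedKernel L M β (klAnisoFamily L M β μ K klE0 (J₁ - 1)) G (2 * m' + 1 + 1) σ x‖ ≤ B (m' + 1) Fc)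
    {α : ℝ} (hα : 0 < α)
    (hrow : ∀ X, ∑ Y, ‖((sectorSubMatrix L M β (bgmFatMultiplier L M klE0 β (nambuXiCT L μ K) (J₁ - 1))).transpose *
        hubbardCovSliceCT L M β μ 0 K (klScale klE0 J₂) (klScale klE0 J₁) *
          sectorSubMatrix L M β (bgmFatMultiplier L M klE0 β (nambuXiCT L μ K) (J₁ - 1))) X Y‖ ≤ α)
    (hcol : ∀ Y, ∑ X, ‖((sectorSubMatrix L M β (bgmFatMultiplier L M klE0 β (nambuXiCT L μ K) (J₁ - 1))).transpose *
        hubbardCovSliceCT L M β μ 0 K (klScale klE0 J₂) (klScale klE0 J₁) *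
          sectorSubMatrix L M β (bgmFatMultiplier L M klE0 β (nambuXiCT L μ K) (J₁ - 1))) X Y‖ ≤ α)
    {ρ : ℝ} (hρ : 0 < ρ)
    (hθ : Real.exp 1 * α * normV (SpaceTimeIdx L M × SectorLeg (sectorCount (J₁ - 1))) κ ρ
      (fun m' => (27 : ℝ) ^ 0 * (imagTimeWeight β M * B m' 0)) / κ ^ 2 < 1)
    {cr cc : ℝ} (hcc0 : 0 ≤ cc)
    (hrow' : ∀ X'', ∑ X', ‖(sectorAnalysisMatrix L M β (klAnisoFamily L M β μ K klE0 J') *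
        sectorSubMatrix L M β (bgmFatMultiplier L M klE0 β (nambuXiCT L μ K) (J₁ - 1))) X'' X'‖ ≤ cr)
    (hcol' : ∀ X', ∑ X'', ‖(sectorAnalysisMatrix L M β (klAnisoFamily L M β μ K klE0 J') *
        sectorSubMatrix L M β (bgmFatMultiplier L M klE0 β (nambuXiCT L μ K) (J₁ - 1))) X'' X'‖ ≤ cc)
    {N₀ : ℕ} (hN₀ : 2 ≤ N₀) {m : ℕ} (p : Fin (m + 1)) (J : Finset (Fin (m + 1))) (hp : p ∉ J)
    (τ'' : Fin (m + 1) → SectorLeg (sectorCount J')) (w'' : SpaceTimeIdx L M × SectorLeg (sectorCount J')) :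
    ∑ X'' ∈ univ.filter (fun X'' : Fin (m + 1) → SpaceTimeIdx L M × SectorLeg (sectorCount J') => X'' p = w'' ∧ ∀ j ∈ J, (X'' j).2 = τ'' j),
        ‖kernel ℂ (ExteriorAlgebra.map (Matrix.toLin' (sectorAnalysisMatrix L M β (klAnisoFamily L M β μ K klE0 J')))
          (effAction ℂ (hubbardCovSliceCT L M β μ 0 K (klScale klE0 J₂) (klScale klE0 J₁)) G -
            gaussConv ℂ (hubbardCovSliceCT L M β μ 0 K (klScale klE0 J₂) (klScale klE0 J₁)) G)) (m + 1) X''‖ ≤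
      cr * cc ^ m *
        (∑ n ∈ Ico 2 N₀, (κ⁻¹ ^ (m + 1) * κ⁻¹ ^ (2 * (n - 1)) * (α ^ (n - 1) * Real.exp n)) *
            ∑ δ ∈ (Fintype.piFinset fun _ : Fin n => range (Fintype.card (SpaceTimeIdx L M × SectorLeg (sectorCount (J₁ - 1))) / 2 + 1)) with
                m + 1 + 2 * (n - 1) ≤ ∑ a, 2 * δ a,
              ∑ pf : J → Fin n, ((∏ j, ((2 * δ (pf j) : ℕ) : ℝ)) / ((∑ a, 2 * δ a : ℕ) : ℝ) ^ J.card) *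
                ∏ a, (Real.exp 3 * κ) ^ (2 * δ a) *
                  ((27 : ℝ) ^ (univ.filter fun j : J => pf j = a).card *
                    (imagTimeWeight β M * B (δ a) (univ.filter fun j : J => pf j = a).card)) +
          ρ⁻¹ ^ (m + 1) * (Real.exp 1 * normV (SpaceTimeIdx L M × SectorLeg (sectorCount (J₁ - 1))) κ ρ
              (fun m' => (27 : ℝ) ^ 0 * (imagTimeWeight β M * B m' 0))) *
            (Real.exp 1 * α * normV (SpaceTimeIdx L M × SectorLeg (sectorCount (J₁ - 1))) κ ρ
                (fun m' => (27 : ℝ) ^ 0 * (imagTimeWeight β M * B m' 0)) / κ ^ 2) ^ (N₀ - 1) /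
            (1 - Real.exp 1 * α * normV (SpaceTimeIdx L M × SectorLeg (sectorCount (J₁ - 1))) κ ρ
                (fun m' => (27 : ℝ) ^ 0 * (imagTimeWeight β M * B m' 0)) / κ ^ 2)) := by
  classical
  have he : (0 : ℝ) < klE0 := by norm_num [klE0]
  have hkJ : J₁ - 1 ≤ J' := by omega
  exact sum_filter_norm_sectorAnalysis_effAction_sub_gaussConv_le_graded_prescribed_of_plateau hβ
    (klAnisoFamily L M β μ K klE0 (J₁ - 1)) (bgmFatMultiplier L M klE0 β (nambuXiCT L μ K) (J₁ - 1))
    (fun ω k => bgmFatMultiplier_mul_bgmMultiplier he β (nambuXiCT L μ K) (J₁ - 1) ω k)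
    (fun k hk ω => klAnisoFamily_eq_zero_of_sum_eq_zero β μ K klE0 (J₁ - 1) k hk ω)
    (klAnisoFamily L M β μ K klE0 J') G hG hG0 _
    (fun X Y hXY => sum_klAnisoFamily_eq_one_of_blockSliceCT_ne_zero β μ K hJ₁ hJ X Y hXY)
    (fun ω' k hne => sum_klAnisoFamily_pred_eq_one_of_klAnisoFamily_ne_zero β μ K hJ₁ hJ' ω' k hne)
    (fun ω'' ω' => ∃ q : FreqMomentum L M, klAnisoFamily L M β μ K klE0 J' ω'' q ≠ 0 ∧
      bgmFatMultiplier L M klE0 β (nambuXiCT L μ K) (J₁ - 1) ω' q ≠ 0)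
    (fun X'' X' hne => overlap_of_sectorAnalysis_mul_sectorSub_ne_zero β _ _ X'' X' hne)
    (by norm_num) (fun ℓ'' => by convert card_parentsLeg_klAniso_le β μ K hkJ ℓ'' using 3)
    hκ hGB B hB0 hB hα hrow hcol hρ hθ hcc0 hrow' hcol' hN₀ p J hp τ'' w''

/-! ## §3 First order of a block step, levelled track -/

/-- **FIRST ORDER OF A BLOCK STEP, PRESCRIBED LEGS (the binomial prescribed door at the block geometry).**  Same geometry, child relation and parents
count; even `G`; degree `2(q+1)` output with legs `J` prescribed to `τ″`, pinned leg `i ∉ J`. -/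
theorem blockStep_firstOrder_lev_le {β : ℝ} (hβ : 0 < β) (μ : ℝ) (K : TrigPolyC4v) {J₁ J₂ J' : ℕ} (hJ₁ : 1 ≤ J₁) (hJ : J₁ ≤ J₂) (hJ' : J₁ ≤ J')
    (G : HubbardGrassmann L M) (hG : G ∈ evenPart ℂ (HubbardFieldIdx L M))
    {κ : ℝ} (hκ : 0 ≤ κ)
    (hGB : IsGramBoundedR ((sectorSubMatrix L M β (bgmFatMultiplier L M klE0 β (nambuXiCT L μ K) (J₁ - 1))).transpose *
      hubbardCovSliceCT L M β μ 0 K (klScale klE0 J₂) (klScale klE0 J₁) *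
        sectorSubMatrix L M β (bgmFatMultiplier L M klE0 β (nambuXiCT L μ K) (J₁ - 1))) κ)
    (B : ℕ → ℕ → ℝ) (hB0 : ∀ m' Fc, 0 ≤ B m' Fc)
    (hB : ∀ (m' Fc : ℕ) (E : Finset (Fin (2 * m' + 1 + 1))) (τ : Fin (2 * m' + 1 + 1) → SectorLeg (sectorCount (J₁ - 1)))
      (q : Fin (2 * m' + 1 + 1)), q ∈ E → E.card = Fc + 1 → ∀ y : SpaceTimeIdx L M,
        imagTimeWeight β M ^ (2 * m' + 1) *
          ∑ σ ∈ univ.filter (fun σ : Fin (2 * m' + 1 + 1) → SectorLeg (sectorCount (J₁ - 1)) => ∀ e ∈ E, σ e = τ e),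
            ∑ x ∈ univ.filter (fun x : Fin (2 * m' + 1 + 1) → SpaceTimeIdx L M => x q = y),
              ‖sectorisedKernel L M β (klAnisoFamily L M β μ K klE0 (J₁ - 1)) G (2 * m' + 1 + 1) σ x‖ ≤ B (m' + 1) Fc)
    {cr cc : ℝ} (hcc0 : 0 ≤ cc)
    (hrow' : ∀ X'', ∑ X', ‖(sectorAnalysisMatrix L M β (klAnisoFamily L M β μ K klE0 J') *
        sectorSubMatrix L M β (bgmFatMultiplier L M klE0 β (nambuXiCT L μ K) (J₁ - 1))) X'' X'‖ ≤ cr)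
    (hcol' : ∀ X', ∑ X'', ‖(sectorAnalysisMatrix L M β (klAnisoFamily L M β μ K klE0 J') *
        sectorSubMatrix L M β (bgmFatMultiplier L M klE0 β (nambuXiCT L μ K) (J₁ - 1))) X'' X'‖ ≤ cc)
    {q : ℕ} (i : Fin (2 * q + 1 + 1)) (J : Finset (Fin (2 * q + 1 + 1))) (hi : i ∉ J)
    (τ'' : Fin (2 * q + 1 + 1) → SectorLeg (sectorCount J')) (w'' : SpaceTimeIdx L M × SectorLeg (sectorCount J')) :
    ∑ X'' ∈ univ.filter (fun X'' : Fin (2 * q + 1 + 1) → SpaceTimeIdx L M × SectorLeg (sectorCount J') =>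
        X'' i = w'' ∧ ∀ j ∈ J, (X'' j).2 = τ'' j),
        ‖kernel ℂ (ExteriorAlgebra.map (Matrix.toLin' (sectorAnalysisMatrix L M β (klAnisoFamily L M β μ K klE0 J')))
          (gaussConv ℂ (hubbardCovSliceCT L M β μ 0 K (klScale klE0 J₂) (klScale klE0 J₁)) G - G)) (2 * q + 1 + 1) X''‖ ≤
      cr * cc ^ (2 * q + 1) *
        ∑ m' ∈ range (Fintype.card (SpaceTimeIdx L M × SectorLeg (sectorCount (J₁ - 1))) / 2 + 1), (if q + 1 < m' then
          ((((2 * (q + 1)).factorial : ℝ))⁻¹ * ((∏ j ∈ univ.filter (fun j : Fin (2 * (q + 1)) => j ∉ J), (2 * m' - (j : ℕ)) : ℕ) : ℝ)) *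
            ((2 * m' : ℕ) : ℝ) ^ J.card * κ ^ (2 * m' - 2 * (q + 1)) * ((27 : ℝ) ^ J.card * (imagTimeWeight β M * B m' J.card)) else 0) := by
  classical
  have he : (0 : ℝ) < klE0 := by norm_num [klE0]
  have hkJ : J₁ - 1 ≤ J' := by omega
  exact sum_filter_norm_sectorAnalysis_gaussConv_sub_le_binomial_prescribed_of_plateau hβ
    (klAnisoFamily L M β μ K klE0 (J₁ - 1)) (bgmFatMultiplier L M klE0 β (nambuXiCT L μ K) (J₁ - 1))
    (fun ω k => bgmFatMultiplier_mul_bgmMultiplier he β (nambuXiCT L μ K) (J₁ - 1) ω k)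
    (fun k hk ω => klAnisoFamily_eq_zero_of_sum_eq_zero β μ K klE0 (J₁ - 1) k hk ω)
    (klAnisoFamily L M β μ K klE0 J') G hG _
    (fun X Y hXY => sum_klAnisoFamily_eq_one_of_blockSliceCT_ne_zero β μ K hJ₁ hJ X Y hXY)
    (fun ω' k hne => sum_klAnisoFamily_pred_eq_one_of_klAnisoFamily_ne_zero β μ K hJ₁ hJ' ω' k hne)
    (fun ω'' ω' => ∃ q : FreqMomentum L M, klAnisoFamily L M β μ K klE0 J' ω'' q ≠ 0 ∧
      bgmFatMultiplier L M klE0 β (nambuXiCT L μ K) (J₁ - 1) ω' q ≠ 0)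
    (fun X'' X' hne => overlap_of_sectorAnalysis_mul_sectorSub_ne_zero β _ _ X'' X' hne)
    (by norm_num) (fun ℓ'' => by convert card_parentsLeg_klAniso_le β μ K hkJ ℓ'' using 3)
    hκ hGB B hB0 hB hcc0 hrow' hcol' i J hi τ'' w''

end Doors

end Summit.HubbardSuperconductivity.HubbardSuperconductivity.Theorems.EngineV8

end
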